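import Literature.InformationTheory.QuantumCodes.CSS
import HarnessLib

/-!
# Puncturing a CSS code at a qubit carrying a weight-one stabilizer: `[[n, k, d]] ⟹ [[n − 1, k, ≥ d]]` (CSS form of CRSS Thm. 6 (e))

Calderbank–Rains–Shor–Sloane 1998, Theorem 6 (e) (printed p. 13): «If `n ≥ 2` and the associated code `C` contains a
vector of weight `1` then an `[[n − 1, k, d]]` code exists» (proof «left to the reader»; the tree proves the additive
statement in `AdditiveCodeShortening.lean`, `CRSS1998_theorem6e`). This file is the CSS-PRESERVING form, in the check-matrix
language of `CSS.lean` (type-02's `CSSCode`), which the additive statement does not give: if the `X`-stabilizer span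
`rs H^X` contains the weight-one word `e_q` (the stabilizer `X_q`), then DELETING COLUMN `q` from both check matrices is
again a CSS code (column `q` of `H^Z` vanishes, since `e_q ∈ rs H^X ⊆ ker H^Z`), with the SAME number of logical qubits
(`rank` of `H^X` drops by exactly one: the restriction `rs H^X → rs H^X|_{p ≠ q}` has kernel `{0, e_q}`; `rank H^Z` is
unchanged) and with `d^X`, `d^Z` NOT smaller (every logical of the punctured code extends by `0` at `q` to a logical of the
original code of the same weight). The `Z_q` case is the `X ↔ Z` swap.

* `CSSCode.puncture C q h` — the punctured code on the qubit type `{p // p ≠ q}` (check matrices `H^X`, `H^Z` with column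
  `q` deleted; commutation from `h : Pi.single q 1 ∈ C.rowSpX`);
* `CSSCode.rank_HZ_puncture` (`= rank H^Z`), `CSSCode.rank_HX_puncture` (`+ 1 = rank H^X`), **`CSSCode.k_puncture`** (`= k`);
* **`CSSCode.dX_le_dX_puncture`**, **`CSSCode.dZ_le_dZ_puncture`** — for `k > 0`: `d^X(C) ≤ d^X(C')`, `d^Z(C) ≤ d^Z(C')`.

Use (why it is here): the «w.l.o.g. `α_1 = β_1 = 0`» step of qec-search-5's CSS linear program (census/search-5/code/css.py:
«a weight-1 stabilizer `X_q` or `Z_q` factors the qubit `q` off: `[[n,k,d]]` CSS → `[[n−1,k,d]]` CSS») — with this file that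
sharper LP (run for every length `m ≤ n`) is kernel-sound as well; `Summits/Ventures/QEC/Census/CSSLPCertificate.lean` so far
uses only the length-`n` system without the w.l.o.g.

References: [CalderbankEtAl1998] §4 Thm. 6 (e) (printed p. 13; arXiv:quant-ph/9608006v5 PDF p. 14); the CSS distances
`d^X`, `d^Z`, `k = n − rk H^X − rk H^Z` as in [BravyiEtAl2024] §4 Lemma 1 (`CSS.lean`). CSS-preservation of the puncturing
is [folklore]. Mathlib / tree search: `lean search 'puncture'` — `SymplecticCodes.puncture` / `AdditiveCodeShortening`
(symplectic, last qubit only, no CSS structure); nothing for `CSSCode`.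
-/

namespace Literature.InformationTheory.QuantumCodes

open Matrix

namespace CSSCode

variable {RX RZ Q : Type*} [Fintype RX] [Fintype RZ] [Fintype Q] [DecidableEq Q]

/-! ### Extension by zero and restriction at one qubit -/

/-- Extend a vector on the qubits `≠ q` by `0` at `q`. Plumbing definition. [cite: CalderbankEtAl1998, §4 Thm. 6 (e) (printed p. 13; puncturing step)] -/
def extendAt (q : Q) (v : {p : Q // p ≠ q} → ZMod 2) : Q → ZMod 2 :=
  fun p => if h : p = q then 0 else v ⟨p, h⟩

omit [Fintype Q] in
/-- `extendAt` vanishes at `q`. [cite: CalderbankEtAl1998, §4 Thm. 6 (e) (printed p. 13; puncturing step)] -/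
@[simp] theorem extendAt_self (q : Q) (v : {p : Q // p ≠ q} → ZMod 2) : extendAt q v q = 0 := by
  simp [extendAt]

omit [Fintype Q] in
/-- `extendAt` agrees with `v` off `q`. [cite: CalderbankEtAl1998, §4 Thm. 6 (e) (printed p. 13; puncturing step)] -/
@[simp] theorem extendAt_val (q : Q) (v : {p : Q // p ≠ q} → ZMod 2) (p : {p : Q // p ≠ q}) :
    extendAt q v p.1 = v p := by
  simp [extendAt, p.2]

omit [Fintype Q] in
/-- Restricting the extension gives back `v`. [cite: CalderbankEtAl1998, §4 Thm. 6 (e) (printed p. 13; puncturing step)] -/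
theorem restrict_extendAt (q : Q) (v : {p : Q // p ≠ q} → ZMod 2) : (fun p : {p : Q // p ≠ q} => extendAt q v p.1) = v := by
  funext p; exact extendAt_val q v p

/-- The extension by zero has the same Hamming weight. [cite: CalderbankEtAl1998, §4 Thm. 6 (e) (printed p. 13; puncturing step)] -/
theorem hammingNorm_extendAt (q : Q) (v : {p : Q // p ≠ q} → ZMod 2) : hammingNorm (extendAt q v) = hammingNorm v := by
  unfold hammingNorm
  have hset : (Finset.univ.filter fun i : Q => extendAt q v i ≠ 0) =
      (Finset.univ.filter fun p : {p : Q // p ≠ q} => v p ≠ 0).map (Function.Embedding.subtype _) := by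
    ext i
    simp only [Finset.mem_filter, Finset.mem_univ, true_and, Finset.mem_map, Function.Embedding.coe_subtype]
    constructor
    · intro hi
      have hiq : i ≠ q := fun h => hi (by rw [h, extendAt_self])
      exact ⟨⟨i, hiq⟩, by rwa [← extendAt_val q v ⟨i, hiq⟩], rfl⟩
    · rintro ⟨p, hp, rfl⟩
      rwa [extendAt_val]
  rw [hset, Finset.card_map]

/-- A sum over the qubits `≠ q` is the full sum minus the `q` term. [folklore] -/
private theorem sum_subtype_ne (q : Q) (g : Q → ZMod 2) :
    ∑ p : {p : Q // p ≠ q}, g p.1 = ∑ p, g p - g q := by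
  rw [← Finset.sum_subtype (Finset.univ.erase q) (by simp) g, eq_sub_iff_add_eq, Finset.sum_erase_add _ _ (Finset.mem_univ q)]

/-- `H *ᵥ (extendAt q v) = H' *ᵥ v` for the column-deleted matrix `H'`. [cite: CalderbankEtAl1998, §4 Thm. 6 (e) (printed p. 13; puncturing step)] -/
theorem submatrix_mulVec_eq_mulVec_extendAt {R : Type*} (H : Matrix R Q (ZMod 2)) (q : Q)
    (v : {p : Q // p ≠ q} → ZMod 2) :
    (H.submatrix id (Subtype.val : {p : Q // p ≠ q} → Q)) *ᵥ v = H *ᵥ extendAt q v := by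
  funext r
  simp only [Matrix.mulVec, dotProduct, Matrix.submatrix_apply, id_eq]
  have h1 := sum_subtype_ne q (fun x => H r x * extendAt q v x)
  simp only [extendAt_val, extendAt_self, mul_zero, sub_zero] at h1
  exact h1

omit [Fintype Q] [DecidableEq Q] in
/-- Restriction maps the row space of `H` into the row space of the column-deleted matrix. [cite: CalderbankEtAl1998, §4 Thm. 6 (e) (printed p. 13; puncturing step)] -/
theorem restrict_mem_rowSpace_submatrix {R : Type*} [Fintype R] (H : Matrix R Q (ZMod 2)) (q : Q) {w : Q → ZMod 2}
    (hw : w ∈ rowSpace H) : (fun p : {p : Q // p ≠ q} => w p.1) ∈ rowSpace (H.submatrix id (Subtype.val)) := by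
  obtain ⟨c, rfl⟩ := (mem_rowSpace_iff H w).1 hw
  exact (mem_rowSpace_iff _ _).2 ⟨c, by funext p; simp [Matrix.vecMul, dotProduct, Matrix.submatrix_apply]⟩

omit [Fintype Q] in
/-- A logical candidate of the punctured side lifts: if `v ∉ rs H'` then `extendAt q v ∉ rs H`. [cite: CalderbankEtAl1998, §4 Thm. 6 (e) (printed p. 13; puncturing step)] -/
theorem extendAt_not_mem_rowSpace {R : Type*} [Fintype R] (H : Matrix R Q (ZMod 2)) (q : Q) {v : {p : Q // p ≠ q} → ZMod 2}
    (hv : v ∉ rowSpace (H.submatrix id (Subtype.val))) : extendAt q v ∉ rowSpace H := fun h => by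
  have := restrict_mem_rowSpace_submatrix H q h
  rw [restrict_extendAt] at this
  exact hv this

/-! ### The punctured code -/

omit [Fintype RZ] in
/-- If `e_q ∈ rs H^X` (a weight-one `X`-stabilizer on qubit `q`), column `q` of `H^Z` vanishes. [cite: CalderbankEtAl1998, §4 Thm. 6 (e) (printed p. 13; puncturing step)] -/
theorem HZ_col_eq_zero (C : CSSCode RX RZ Q) {q : Q} (h : Pi.single q 1 ∈ C.rowSpX) (s : RZ) : C.HZ s q = 0 := by
  have hker : C.HZ *ᵥ Pi.single q 1 = 0 := C.rowSpX_le_kerZ h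
  have := congrFun hker s
  rwa [Matrix.mulVec, dotProduct_single_one, Pi.zero_apply] at this

omit [Fintype RZ] in
/-- **The punctured CSS code** at a qubit `q` carrying the `X`-stabilizer `X_q` (`e_q ∈ rs H^X`): delete column `q` from both
check matrices. Commutation: `Σ_{p ≠ q} H^X_{rp} H^Z_{sp} = (H^X (H^Z)ᵀ)_{rs} − H^X_{rq} H^Z_{sq} = 0` since column `q` of `H^Z`
is zero. (The `Z_q` case is `C.swap.puncture`.) [cite: CalderbankEtAl1998, §4 Thm. 6 (e) (printed p. 13)] -/
def puncture (C : CSSCode RX RZ Q) (q : Q) (h : Pi.single q 1 ∈ C.rowSpX) : CSSCode RX RZ {p : Q // p ≠ q} :=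
  ofMatrices (C.HX.submatrix id Subtype.val) (C.HZ.submatrix id Subtype.val) (by
    ext r s
    have hc := congrFun (congrFun C.comm r) s
    simp only [Matrix.mul_apply, Matrix.transpose_apply, Matrix.submatrix_apply, id_eq, Matrix.zero_apply] at hc ⊢
    rw [sum_subtype_ne q (fun p => C.HX r p * C.HZ s p), hc, C.HZ_col_eq_zero h s, mul_zero, sub_zero])

omit [Fintype RZ] in
/-- The check matrices of the punctured code. [cite: CalderbankEtAl1998, §4 Thm. 6 (e) (printed p. 13; puncturing step)] -/
@[simp] theorem puncture_HX (C : CSSCode RX RZ Q) (q : Q) (h : Pi.single q 1 ∈ C.rowSpX) :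
    (C.puncture q h).HX = C.HX.submatrix id Subtype.val := rfl

omit [Fintype RZ] in
/-- The check matrices of the punctured code. [cite: CalderbankEtAl1998, §4 Thm. 6 (e) (printed p. 13; puncturing step)] -/
@[simp] theorem puncture_HZ (C : CSSCode RX RZ Q) (q : Q) (h : Pi.single q 1 ∈ C.rowSpX) :
    (C.puncture q h).HZ = C.HZ.submatrix id Subtype.val := rfl

/-! ### Distances do not drop -/

omit [Fintype RZ] in
/-- **`d^X(C) ≤ d^X(C')`** for the punctured code `C'` (when `C'` has an `X`-logical, e.g. `k > 0`): an `X`-logical `v` of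
`C'` extends by `0` to an `X`-logical of `C` of the same weight. [cite: CalderbankEtAl1998, §4 Thm. 6 (e) (printed p. 13)] -/
theorem dX_le_dX_puncture (C : CSSCode RX RZ Q) (q : Q) (h : Pi.single q 1 ∈ C.rowSpX) (hk : 0 < (C.puncture q h).k) :
    C.dX ≤ (C.puncture q h).dX := by
  refine (C.puncture q h).le_dX (((C.puncture q h).dX_pos_iff).1 ((C.puncture q h).dX_pos_of_k_pos hk)) ?_
  intro v hv hv'
  rw [puncture_HZ, submatrix_mulVec_eq_mulVec_extendAt] at hv
  change v ∉ rowSpace (C.HX.submatrix id Subtype.val) at hv'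
  rw [← hammingNorm_extendAt q v]
  exact C.dX_le_hammingNorm hv (extendAt_not_mem_rowSpace C.HX q hv')

/-- **`d^Z(C) ≤ d^Z(C')`** likewise (`Z`-logicals of `C'` extend by `0`). [cite: CalderbankEtAl1998, §4 Thm. 6 (e) (printed p. 13)] -/
theorem dZ_le_dZ_puncture (C : CSSCode RX RZ Q) (q : Q) (h : Pi.single q 1 ∈ C.rowSpX) (hk : 0 < (C.puncture q h).k) :
    C.dZ ≤ (C.puncture q h).dZ := by
  refine (C.puncture q h).le_dZ (((C.puncture q h).dZ_pos_iff).1 ((C.puncture q h).dZ_pos_of_k_pos hk)) ?_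
  intro v hv hv'
  rw [puncture_HX, submatrix_mulVec_eq_mulVec_extendAt] at hv
  change v ∉ rowSpace (C.HZ.submatrix id Subtype.val) at hv'
  rw [← hammingNorm_extendAt q v]
  exact C.dZ_le_hammingNorm hv (extendAt_not_mem_rowSpace C.HZ q hv')

/-! ### The number of logical qubits is unchanged -/

/-- The restriction at `q` as a linear map. Plumbing definition. [cite: CalderbankEtAl1998, §4 Thm. 6 (e) (printed p. 13; puncturing step)] -/
def restrictAt (q : Q) : (Q → ZMod 2) →ₗ[ZMod 2] ({p : Q // p ≠ q} → ZMod 2) where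
  toFun w p := w p.1
  map_add' _ _ := rfl
  map_smul' _ _ := rfl

omit [Fintype Q] [DecidableEq Q] in
/-- Value of `restrictAt`. [cite: CalderbankEtAl1998, §4 Thm. 6 (e) (printed p. 13; puncturing step)] -/
@[simp] theorem restrictAt_apply (q : Q) (w : Q → ZMod 2) (p : {p : Q // p ≠ q}) : restrictAt q w p = w p.1 := rfl

omit [Fintype Q] [DecidableEq Q] in
/-- The row space of the column-deleted matrix is the image of the row space under restriction. [cite: CalderbankEtAl1998, §4 Thm. 6 (e) (printed p. 13; puncturing step)] -/
theorem rowSpace_submatrix_eq_map {R : Type*} [Fintype R] (H : Matrix R Q (ZMod 2)) (q : Q) :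
    rowSpace (H.submatrix id (Subtype.val : {p : Q // p ≠ q} → Q)) = (rowSpace H).map (restrictAt q) := by
  ext v
  rw [Submodule.mem_map]
  constructor
  · intro hv
    obtain ⟨c, rfl⟩ := (mem_rowSpace_iff _ _).1 hv
    refine ⟨c ᵥ* H, (mem_rowSpace_iff _ _).2 ⟨c, rfl⟩, ?_⟩
    funext p; simp [Matrix.vecMul, dotProduct, Matrix.submatrix_apply]
  · rintro ⟨w, hw, rfl⟩
    exact restrict_mem_rowSpace_submatrix H q hw

/-- A word in the row space of `H^Z` vanishes at `q` (column `q` of `H^Z` is zero). [cite: CalderbankEtAl1998, §4 Thm. 6 (e) (printed p. 13; puncturing step)] -/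
theorem apply_eq_zero_of_mem_rowSpZ (C : CSSCode RX RZ Q) {q : Q} (h : Pi.single q 1 ∈ C.rowSpX) {w : Q → ZMod 2}
    (hw : w ∈ C.rowSpZ) : w q = 0 := by
  obtain ⟨c, rfl⟩ := (mem_rowSpace_iff _ _).1 hw
  simp only [Matrix.vecMul, dotProduct]
  exact Finset.sum_eq_zero fun s _ => by rw [C.HZ_col_eq_zero h s, mul_zero]

/-- **`rank H^Z` is unchanged** by the puncturing (restriction is injective on `rs H^Z`, whose words vanish at `q`).
[cite: CalderbankEtAl1998, §4 Thm. 6 (e) (printed p. 13)] -/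
theorem rank_HZ_puncture (C : CSSCode RX RZ Q) (q : Q) (h : Pi.single q 1 ∈ C.rowSpX) :
    (C.puncture q h).HZ.rank = C.HZ.rank := by
  rw [← finrank_rowSpace_eq_rank, ← finrank_rowSpace_eq_rank, puncture_HZ, rowSpace_submatrix_eq_map,
    ← LinearMap.range_domRestrict]
  have hker : LinearMap.ker ((restrictAt q).domRestrict (rowSpace C.HZ)) = ⊥ := by
    rw [eq_bot_iff]
    rintro ⟨w, hw⟩ hw0
    rw [LinearMap.mem_ker, LinearMap.domRestrict_apply] at hw0
    rw [Submodule.mem_bot, Subtype.ext_iff, Submodule.coe_zero]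
    funext p
    by_cases hp : p = q
    · subst hp; exact C.apply_eq_zero_of_mem_rowSpZ h hw
    · exact congrFun hw0 ⟨p, hp⟩
  have hdim := LinearMap.finrank_range_add_finrank_ker ((restrictAt q).domRestrict (rowSpace C.HZ))
  rw [hker, finrank_bot, add_zero] at hdim
  exact hdim

omit [Fintype RZ] in
/-- **`rank H^X` drops by exactly one**: the restriction `rs H^X → rs H^X|_{p ≠ q}` is onto with kernel `{0, e_q}`.
[cite: CalderbankEtAl1998, §4 Thm. 6 (e) (printed p. 13)] -/
theorem rank_HX_puncture (C : CSSCode RX RZ Q) (q : Q) (h : Pi.single q 1 ∈ C.rowSpX) :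
    (C.puncture q h).HX.rank + 1 = C.HX.rank := by
  rw [← finrank_rowSpace_eq_rank, ← finrank_rowSpace_eq_rank, puncture_HX, rowSpace_submatrix_eq_map,
    ← LinearMap.range_domRestrict]
  have hle : Submodule.span (ZMod 2) {(Pi.single q 1 : Q → ZMod 2)} ≤ rowSpace C.HX :=
    Submodule.span_le.2 (Set.singleton_subset_iff.2 h)
  have hker : LinearMap.ker ((restrictAt q).domRestrict (rowSpace C.HX)) =
      (Submodule.span (ZMod 2) {(Pi.single q 1 : Q → ZMod 2)}).comap (rowSpace C.HX).subtype := by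
    ext ⟨w, hw⟩
    simp only [LinearMap.mem_ker, LinearMap.domRestrict_apply, Submodule.mem_comap, Submodule.subtype_apply,
      Submodule.mem_span_singleton]
    constructor
    · intro h0
      refine ⟨w q, ?_⟩
      funext p
      by_cases hp : p = q
      · subst hp; simp
      · have := congrFun h0 ⟨p, hp⟩
        rw [restrictAt_apply, Pi.zero_apply] at this
        simp [hp, this]
    · rintro ⟨a, rfl⟩
      funext p
      rw [restrictAt_apply, Pi.zero_apply, Pi.smul_apply, Pi.single_apply, if_neg p.2, smul_zero]
  have hdim := LinearMap.finrank_range_add_finrank_ker ((restrictAt q).domRestrict (rowSpace C.HX))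
  rw [hker, LinearEquiv.finrank_eq (Submodule.comapSubtypeEquivOfLe hle),
    finrank_span_singleton (by simp : (Pi.single q 1 : Q → ZMod 2) ≠ 0)] at hdim
  exact hdim

omit [Fintype RZ] in
/-- The weight-one stabilizer forces `rank H^X ≥ 1`. [cite: CalderbankEtAl1998, §4 Thm. 6 (e) (printed p. 13; puncturing step)] -/
theorem one_le_rank_HX (C : CSSCode RX RZ Q) {q : Q} (h : Pi.single q 1 ∈ C.rowSpX) : 1 ≤ C.HX.rank := by
  rw [← finrank_rowSpace_eq_rank]
  have hle : Submodule.span (ZMod 2) {(Pi.single q 1 : Q → ZMod 2)} ≤ rowSpace C.HX :=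
    Submodule.span_le.2 (Set.singleton_subset_iff.2 h)
  have := Submodule.finrank_mono hle
  rwa [finrank_span_singleton (by simp : (Pi.single q 1 : Q → ZMod 2) ≠ 0)] at this

/-- **`k` is unchanged**: `k(C') = (n − 1) − (rank H^X − 1) − rank H^Z = k(C)`.
[cite: CalderbankEtAl1998, §4 Thm. 6 (e) (printed p. 13: "an [[n − 1, k, d]] code exists")] -/
theorem k_puncture (C : CSSCode RX RZ Q) (q : Q) (h : Pi.single q 1 ∈ C.rowSpX) : (C.puncture q h).k = C.k := by
  rw [CSSCode.k_eq, CSSCode.k_eq, rank_HZ_puncture]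
  have hcard : Fintype.card {p : Q // p ≠ q} = Fintype.card Q - 1 := by
    rw [show Fintype.card {p : Q // p ≠ q} = Fintype.card {p : Q // ¬ (p = q)} from rfl, Fintype.card_subtype_compl,
      Fintype.card_subtype_eq]
  rw [hcard]
  have h1 := C.rank_HX_puncture q h
  have h2 := C.one_le_rank_HX h
  have h3 := C.rank_HX_add_rank_HZ_le
  have h4 : 1 ≤ Fintype.card Q := Fintype.card_pos_iff.2 ⟨q⟩
  omega

/-- **CRSS Theorem 6 (e), CSS form, packaged**: a CSS code with `k > 0` whose `X`-stabilizer span contains the weight-one word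
`e_q` punctures at `q` to a CSS code on one qubit fewer with the same `k` and `d^X`, `d^Z` at least as large. (For a weight-one
`Z`-stabilizer apply this to `C.swap`.) [cite: CalderbankEtAl1998, §4 Thm. 6 (e) (printed p. 13)] -/
theorem puncture_params (C : CSSCode RX RZ Q) (q : Q) (h : Pi.single q 1 ∈ C.rowSpX) (hk : 0 < C.k) :
    (C.puncture q h).k = C.k ∧ C.dX ≤ (C.puncture q h).dX ∧ C.dZ ≤ (C.puncture q h).dZ :=
  ⟨C.k_puncture q h, C.dX_le_dX_puncture q h (by rw [C.k_puncture q h]; exact hk),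
    C.dZ_le_dZ_puncture q h (by rw [C.k_puncture q h]; exact hk)⟩

end CSSCode

end Literature.InformationTheory.QuantumCodes
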